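import Summits.Ventures.PercRepro.C041SeedCoverAll
import Summits.Ventures.PercRepro.C041TriangleUniversal

/-!
# THE TYPE-SWAP INVOLUTION, AND EVERY MARKED VERTEX AGAINST EVERY CONE ELEMENT (mine-3, gen 66; C-041.md §21 (bb))

The mirror symmetry of the row — exchanging the two terminal types — is the involution `sw` of six-vectors
`(L₀, L₁, L₂, M₀, M₁, M₂) ↦ (L₀, L₂, L₁, M₀, M₂, M₁)`.  It sends the generator `v a` to `v (1 − a)` (`sw_v`), hence a
pure root `V a` to the pure root `V (1 − a)` (`sw_V`), so it preserves the cone (`InCone_sw`); it is multiplicative and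
commutes with the closure `ℓψ` (`ellv_sw`) and with the triangle map (`thetaTri_sw`: `θ_△(sw w, sw w′) = sw (θ_△(w, w′))`).
Every «mirror» statement of the row is therefore one rewrite away from its twin.  CONSEQUENCES: the single 2-mark against
every star (`InCone_thetaTri_v0_V`, the mirror of `InCone_thetaTri_v1_V`); with the universal (1,1)-vertex and rays of
`C041TriangleUniversal` and the seeds reduction of `C041TriangleRayStar`, **EVERY MARKED VERTEX `X(p,q) = v 1 ^ p * v 0 ^ q`
IS IN THE CONE AGAINST EVERY STAR** (`InCone_thetaTri_marks_V`, all `p, q ≥ 0`), and — the triangle map being bilinear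
and the cone generated by the stars — **AGAINST EVERY CONE ELEMENT** (`InCone_thetaTri_marks_any'`, `_any_marks'`): the
cone form of THEOREM (ONE MARKED VERTEX) at an exit of the triangle, for any zone in the cone at the other exit; with the
cycle corollary `InCone_thetaCyc_marks_any'` (every two-exit cycle carrying a marked vertex and any cone zone).  What
remains of the pure-star hypothesis `H` of `InCone_thetaTri_of_pure` is the case of two stars with leaves in `(0, 1)`.
-/

namespace PercRepro

namespace RelaxedTriangle

open TreeClosure

/-! ## The involution -/

/-- The type swap `sw (L₀, L₁, L₂, M₀, M₁, M₂) = (L₀, L₂, L₁, M₀, M₂, M₁)`. -/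
def sw (w : Vec6) : Vec6 := ![w 0, w 2, w 1, w 3, w 5, w 4]

/-- `sw` is an involution. -/
theorem sw_sw (w : Vec6) : sw (sw w) = w := by
  ext i
  fin_cases i <;> simp [sw]

/-- `sw (v a) = v (1 − a)`: the swap is the mirror of the leaf curve. -/
theorem sw_v (a : ℝ) : sw (v a) = v (1 - a) := by
  ext i
  fin_cases i <;> simp [sw, v, mul_comm]

/-- `sw` is multiplicative. -/
theorem sw_mul (w w' : Vec6) : sw (w * w') = sw w * sw w' := by
  ext i
  fin_cases i <;> simp [sw]

/-- `sw` is additive. -/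
theorem sw_add (w w' : Vec6) : sw (w + w') = sw w + sw w' := by
  ext i
  fin_cases i <;> simp [sw]

/-- `sw` is homogeneous. -/
theorem sw_smul (c : ℝ) (w : Vec6) : sw (c • w) = c • sw w := by
  ext i
  fin_cases i <;> simp [sw]

/-- `sw 1 = 1`. -/
theorem sw_one : sw (1 : Vec6) = 1 := by
  ext i
  fin_cases i <;> simp [sw]

/-- `sw (V a) = V (1 − a)`: the swap sends pure roots to pure roots. -/
theorem sw_V {m : ℕ} (a : Fin m → ℝ) : sw (V a) = V (fun i => 1 - a i) := by
  unfold V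
  induction m with
  | zero => simp [sw_one]
  | succ n ih =>
    rw [Fin.prod_univ_castSucc, Fin.prod_univ_castSucc, sw_mul, ih (fun i => a i.castSucc), sw_v]

/-- **The cone is invariant under the type swap.** -/
theorem InCone_sw {w : Vec6} (hw : InCone w) : InCone (sw w) := by
  induction hw with
  | pure a ha =>
    rw [sw_V]
    exact InCone.pure _ (fun i => ⟨by linarith [(ha i).2], by linarith [(ha i).1]⟩)
  | add _ _ ihx ihy => rw [sw_add]; exact ihx.add ihy
  | smul c hc _ ih => rw [sw_smul]; exact ih.smul c hc

/-- `sw` commutes with the closure `ℓψ`. -/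
theorem ellv_sw (w : Vec6) : ellv (sw w) = sw (ellv w) := by
  ext i
  fin_cases i <;> simp [sw, ellv, ell] <;> ring

/-- **`sw` commutes with the triangle map**: `θ_△(sw w, sw w′) = sw (θ_△(w, w′))`. -/
theorem thetaTri_sw (w w' : Vec6) : thetaTri (sw w) (sw w') = sw (thetaTri w w') := by
  ext i
  simp only [thetaTri_eq_vec, sw]
  fin_cases i <;> simp <;> ring

/-- `sw` commutes with the cycle map. -/
theorem thetaCyc_sw (p q s : ℝ) (w w' : Vec6) : thetaCyc p q s (sw w) (sw w') = sw (thetaCyc p q s w w') := by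
  have hn : ∀ x : Vec6, nAdm (sw x) = nAdm x := by
    intro x
    simp only [nAdm, sw]
    simp
    ring
  have h1 : ellv (sw (ellv w) * sw w') = sw (ellv (ellv w * w')) := by rw [← sw_mul, ellv_sw]
  have h2 : ellv (sw w * sw (ellv w')) = sw (ellv (w * ellv w')) := by rw [← sw_mul, ellv_sw]
  have h3 : nAdm (sw w * sw w') = nAdm (w * w') := by rw [← sw_mul, hn]
  rw [thetaCyc_eq, thetaCyc_eq, thetaTri_sw, ellv_sw, ellv_sw, h1, h2, h3, hn, hn]
  simp only [sw_add, sw_smul, sw_mul, sw_one]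

/-! ## The single 2-mark against every star, and every marked vertex against every star -/

/-- **THE SINGLE 2-MARK AGAINST EVERY STAR**: the mirror of `InCone_thetaTri_v1_V`. -/
theorem InCone_thetaTri_v0_V {m : ℕ} (b : Fin m → ℝ) (hb : ∀ i, 0 ≤ b i ∧ b i ≤ 1) :
    InCone (thetaTri (v 0) (V b)) := by
  have h := InCone_thetaTri_v1_V (fun i => 1 - b i) (fun i => ⟨by linarith [(hb i).2], by linarith [(hb i).1]⟩)
  have e : thetaTri (v 0) (V b) = sw (thetaTri (v 1) (V (fun i => 1 - b i))) := by
    rw [← thetaTri_sw, sw_V, sw_v]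
    congr 1
    · norm_num
    · congr 1; funext i; ring
  rw [e]
  exact InCone_sw h

/-- **EVERY MARKED VERTEX AGAINST EVERY STAR**: `θ_△(X(p,q), V b) ∈ cone` for all `p, q ≥ 0` and every star `b`. -/
theorem InCone_thetaTri_marks_V (p q : ℕ) {m : ℕ} (b : Fin m → ℝ) (hb : ∀ i, 0 ≤ b i ∧ b i ≤ 1) :
    InCone (thetaTri (v 1 ^ p * v 0 ^ q) (V b)) :=
  InCone_thetaTri_marks_V_of_seeds b hb (InCone_thetaTri_X11 (InCone_V b hb)) (InCone_thetaTri_v1_V b hb)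
    (InCone_thetaTri_v0_V b hb) p q

/-! ## Every marked vertex against every cone element -/

/-- The single 1-mark against every cone element (bilinearity from the stars). -/
theorem InCone_thetaTri_v1_any {w : Vec6} (hw : InCone w) : InCone (thetaTri (v 1) w) := by
  induction hw with
  | pure b hb => exact InCone_thetaTri_v1_V b hb
  | add _ _ ihx ihy => rw [thetaTri_add_right]; exact ihx.add ihy
  | smul c hc _ ih => rw [thetaTri_smul_right]; exact ih.smul c hc

/-- The single 2-mark against every cone element. -/
theorem InCone_thetaTri_v0_any {w : Vec6} (hw : InCone w) : InCone (thetaTri (v 0) w) := by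
  induction hw with
  | pure b hb => exact InCone_thetaTri_v0_V b hb
  | add _ _ ihx ihy => rw [thetaTri_add_right]; exact ihx.add ihy
  | smul c hc _ ih => rw [thetaTri_smul_right]; exact ih.smul c hc

/-- **THEOREM (ONE MARKED VERTEX, cone form, at the triangle)**: `θ_△(X(p,q), w) ∈ cone` for every marked vertex
`X(p,q)`, `p, q ≥ 0`, and every cone element `w`. -/
theorem InCone_thetaTri_marks_any' (p q : ℕ) {w : Vec6} (hw : InCone w) :
    InCone (thetaTri (v 1 ^ p * v 0 ^ q) w) :=
  InCone_thetaTri_marks_of_seeds hw (InCone_thetaTri_X11 hw) (InCone_thetaTri_v1_any hw) (InCone_thetaTri_v0_any hw)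
    (InCone_thetaTri_eT1 hw) (InCone_thetaTri_eT2 hw) p q

/-- The mirror `θ_△(w, X(p,q))`. -/
theorem InCone_thetaTri_any_marks' (p q : ℕ) {w : Vec6} (hw : InCone w) :
    InCone (thetaTri w (v 1 ^ p * v 0 ^ q)) := by
  rw [thetaTri_comm]
  exact InCone_thetaTri_marks_any' p q hw

/-- **Every two-exit cycle carrying a marked vertex (any marks `p, q ≥ 0`) and ANY cone zone lies in the cone.** -/
theorem InCone_thetaCyc_marks_any' (p₀ q₀ : ℕ) {w : Vec6} (hw : InCone w)
    {p q s : ℝ} (hp : 0 ≤ p) (hq : 0 ≤ q) (hs : 0 ≤ s) : InCone (thetaCyc p q s (v 1 ^ p₀ * v 0 ^ q₀) w) :=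
  InCone_thetaCyc_of_InCone_tri ((InCone_pow_v_one p₀).mul (InCone_pow_v_zero q₀)) hw
    (InCone_thetaTri_marks_any' p₀ q₀ hw) hp hq hs

/-- A star whose leaves all lie in `{0, 1}` is a marked vertex: `V b = v 1 ^ p * v 0 ^ q` with `p` the number of
leaves equal to `1` and `q` the number equal to `0`. -/
theorem V_eq_marks_of_boundary {m : ℕ} (b : Fin m → ℝ) (hb : ∀ i, 0 ≤ b i ∧ b i ≤ 1)
    (h : ¬ ∃ j, 0 < b j ∧ b j < 1) : ∃ p q : ℕ, V b = v 1 ^ p * v 0 ^ q := by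
  classical
  have hb' : ∀ j, b j = 1 ∨ b j = 0 := by
    intro j
    by_contra hc
    obtain ⟨h1, h0⟩ := not_or.1 hc
    exact h ⟨j, lt_of_le_of_ne (hb j).1 (Ne.symm h0), lt_of_le_of_ne (hb j).2 h1⟩
  refine ⟨(Finset.univ.filter fun j => b j = 1).card, (Finset.univ.filter fun j => ¬ b j = 1).card, ?_⟩
  unfold V
  rw [← Finset.prod_filter_mul_prod_filter_not Finset.univ (fun j => b j = 1)]
  congr 1
  · exact (Finset.prod_congr rfl fun j hj => by rw [(Finset.mem_filter.1 hj).2]).trans (Finset.prod_const _)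
  · refine (Finset.prod_congr rfl fun j hj => ?_).trans (Finset.prod_const _)
    have hj1 := (Finset.mem_filter.1 hj).2
    rcases hb' j with h1 | h0
    · exact absurd h1 hj1
    · rw [h0]

/-- **The pure-star hypothesis `H` reduces to two stars with a leaf in `(0, 1)` each**: if `θ_△(V a, V b) ∈ cone`
whenever both stars have a leaf strictly between 0 and 1, it holds for all stars (a star with every leaf in `{0, 1}`
is a marked vertex, settled by `InCone_thetaTri_marks_V`). -/
theorem InCone_thetaTri_of_pure_interior
    (H : ∀ {m m' : ℕ} (a : Fin m → ℝ) (b : Fin m' → ℝ), (∀ i, 0 ≤ a i ∧ a i ≤ 1) → (∀ j, 0 ≤ b j ∧ b j ≤ 1) →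
      (∃ i, 0 < a i ∧ a i < 1) → (∃ j, 0 < b j ∧ b j < 1) → InCone (thetaTri (V a) (V b)))
    {w w' : Vec6} (hw : InCone w) (hw' : InCone w') : InCone (thetaTri w w') := by
  refine InCone_thetaTri_of_pure (fun {m m'} a b ha hb => ?_) hw hw'
  by_cases hi : ∃ i, 0 < a i ∧ a i < 1
  · by_cases hj : ∃ j, 0 < b j ∧ b j < 1
    · exact H a b ha hb hi hj
    · -- `b` is a marked vertex
      obtain ⟨p, q, e⟩ := V_eq_marks_of_boundary b hb hj
      rw [e]
      exact InCone_thetaTri_any_marks' p q (InCone_V a ha)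
  · obtain ⟨p, q, e⟩ := V_eq_marks_of_boundary a ha hi
    rw [e]
    exact InCone_thetaTri_marks_any' p q (InCone_V b hb)

end RelaxedTriangle

end PercRepro
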